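import Mathlib
import Literature.Probability.Percolation.PercolationProofs
import Literature.Probability.LatticeModels.ProdBernoulliIndependence
import Literature.Probability.LatticeModels.ProdBernoulliClusterLocality
import HarnessLib

/-! # Crux `PercNearOneGluing.AdditiveGluing` (stmt-CriticalPhenomena-4576), line `sigma-recursion-lemma5-any-relay` — stub `stub_sigmaRecursion`

Helper file for the crux (lead prover-line-stmt-CriticalPhenomena-4576-0, wave 1): the
BOOKKEEPING part of the σ-recursion engine of Kozma–Nitzan (arXiv:2401.12397, §3.2, proofs of
Thms 4–5, pp. 13–14), in block form.  Proves exactly the registered stub signature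
`stub_sigmaRecursion`; lands with `--supports stmt-CriticalPhenomena-4576`.

## Content

Finite weighted graph on `Fin n`, weights `w`, observer block `O` contracted
(`μ = prodBernoulli (glue w O)`, weight `1` on the non-loop pairs inside `O`).  For a finite set
`S` let `L_S = {ω | ∀ x, x ∈ S ↔ (x ∉ O ∧ ∃ o ∈ O, s(o,x) ∈ ω)}` ("the layer of `ω` is `S`"),
`Ψ_S ω = {e ∈ ω | e avoids O} ∪ {non-loop pairs inside S}` and
`μ'_S = prodBernoulli (glue (kill w O) S)`.  GIVEN, as displayed hypotheses, the conditional
cluster geometry (on `L_S` and the `O`-clique event `K`, the events `{O ↔ X}`, `{u ↔ v}` of `ω`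
are the events `{S ↔ X}`, `{u ↔ v}` of `Ψ_S ω`) and the law of the decomposition
(`μ(L_S ∩ Ψ_S⁻¹ E) = μ(L_S) · μ'_S(E)`), together with the Lemma-5 comparison `hL5` on layers
meeting `A` and the designated inequality `hdef` on layers avoiding `A ∪ {b}`, we prove
`μ(O ↔ A) − μ(O ↔ b) ≤ 1 − μ(a ↔ b)`.

## Proof

(1) Partition every `μ`-probability by the value of the layer
(`μ F = Σ_S μ(L_S ∩ F)`, `Σ_S μ(L_S) = 1`; `sum_measureReal_preimage_singleton`).
(2) `μ(Kᶜ) = 0` (each non-loop pair inside `O` has weight `1`), so inside `L_S` one may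
replace an event by any event agreeing with it on `K` (`measure_inter_conull`).
(3) Rewrite `{O ↔ A}`, `{O ↔ b}`, `{a ↔ b}` through `Ψ_S` (geometry) and factor (law):
`μ(L_S ∩ F) = μ(L_S) · μ'_S(F')`.
(4) Compare termwise: `μ(L_S) = 0` kills the term; `μ(L_S) > 0` forces
`∀ x ∈ S, x ∉ O ∧ ∃ o ∈ O, w s(o,x) ≠ 0` (otherwise `L_S` is empty or lies in the null event
"some weight-0 pair is open"), and then the bracket `μ'_S(S↔A) − μ'_S(S↔b) ≤ 1 − μ'_S(a↔b)`
follows by cases: `S = ∅` (empty unions), `b ∈ S` (`{S ↔ b} = univ`), `S ∩ A ≠ ∅` (`hL5` and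
`μ'_S(S↔A) ≤ 1`), `S ≠ ∅` avoiding `A ∪ {b}` (`hdef`).

No new definitions: all objects (weights, `Ψ`, `K`) enter the helper lemmas as variables with
characterising hypotheses. -/

namespace Summit.CriticalPhenomena.PercolationContinuityZ3.Theorems

open MeasureTheory Set
open Literature.Probability.LatticeModels (prodBernoulli)
open Literature.Probability.Percolation (BondConfig openConn openGraph)

noncomputable section
open Classical

variable {n : ℕ}

/-! ### Generic measure bookkeeping on the finite configuration space -/

/-- Partition by the fibres of a finite-valued map: `Σ_S μ(f⁻¹{S} ∩ F) = μ(F)`. -/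
theorem sigmaRec_sum_preimage_inter (p : Sym2 (Fin n) → unitInterval)
    (f : BondConfig (Fin n) → Finset (Fin n)) (F : Set (BondConfig (Fin n))) :
    ∑ S : Finset (Fin n), (prodBernoulli p).real (f ⁻¹' {S} ∩ F) = (prodBernoulli p).real F := by
  have h1 : ∀ S : Finset (Fin n), MeasurableSet (f ⁻¹' {S}) := fun S =>
    (Set.toFinite _).measurableSet
  have h := sum_measureReal_preimage_singleton (μ := (prodBernoulli p).restrict F)
    (Finset.univ : Finset (Finset (Fin n))) (f := f) (fun S _ => h1 S)
  rw [Finset.coe_univ, Set.preimage_univ, measureReal_restrict_apply MeasurableSet.univ,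
    Set.univ_inter] at h
  rw [← h]
  exact Finset.sum_congr rfl fun S _ => (measureReal_restrict_apply (h1 S)).symm

/-- The layer event `{ω | ∀ x, x ∈ S ↔ (x ∉ O ∧ ∃ o ∈ O, s(o,x) ∈ ω)}` is the fibre over `S` of
the layer map `ω ↦ {x ∉ O | ∃ o ∈ O, s(o,x) ∈ ω}`. -/
theorem sigmaRec_preimage_layer (O S : Finset (Fin n)) :
    (fun ω : BondConfig (Fin n) =>
        Finset.univ.filter fun x : Fin n => x ∉ O ∧ ∃ o ∈ O, s(o, x) ∈ ω) ⁻¹' {S} =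
      {ω | ∀ x : Fin n, x ∈ S ↔ (x ∉ O ∧ ∃ o ∈ O, s(o, x) ∈ ω)} := by
  ext ω
  simp only [Set.mem_preimage, Set.mem_singleton_iff, Finset.ext_iff, Finset.mem_filter,
    Finset.mem_univ, true_and, Set.mem_setOf_eq]
  exact forall_congr' fun x => Iff.comm

/-- Partition of an event by the value of the layer: `μ(F) = Σ_S μ(L_S ∩ F)`. -/
theorem sigmaRec_partition (p : Sym2 (Fin n) → unitInterval) (O : Finset (Fin n))
    (F : Set (BondConfig (Fin n))) :
    (prodBernoulli p).real F = ∑ S : Finset (Fin n), (prodBernoulli p).real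
      ({ω | ∀ x : Fin n, x ∈ S ↔ (x ∉ O ∧ ∃ o ∈ O, s(o, x) ∈ ω)} ∩ F) := by
  rw [← sigmaRec_sum_preimage_inter p
    (fun ω : BondConfig (Fin n) =>
      Finset.univ.filter fun x : Fin n => x ∉ O ∧ ∃ o ∈ O, s(o, x) ∈ ω) F]
  exact Finset.sum_congr rfl fun S _ => by rw [sigmaRec_preimage_layer]

/-- An event outside which some weight-`1` coordinate is closed is conull. -/
theorem sigmaRec_conull (p : Sym2 (Fin n) → unitInterval) (K : Set (BondConfig (Fin n)))
    (hK : ∀ ω, ω ∉ K → ∃ e, p e = 1 ∧ e ∉ ω) : prodBernoulli p Kᶜ = 0 := by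
  have hsub : Kᶜ ⊆ ⋃ e ∈ (Finset.univ.filter fun e : Sym2 (Fin n) => p e = 1),
      {ω : BondConfig (Fin n) | e ∉ ω} := by
    intro ω hω
    obtain ⟨e, he, heω⟩ := hK ω hω
    exact Set.mem_iUnion₂.2 ⟨e, Finset.mem_filter.2 ⟨Finset.mem_univ _, he⟩, heω⟩
  refine measure_mono_null hsub
    (nonpos_iff_eq_zero.1 ((measure_biUnion_finset_le _ _).trans (le_of_eq ?_)))
  refine Finset.sum_eq_zero fun e he => ?_
  have hr : (prodBernoulli p).real {ω : BondConfig (Fin n) | e ∉ ω} = 0 := by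
    rw [Literature.Probability.LatticeModels.prodBernoulli_real_setOf_notMem,
      (Finset.mem_filter.1 he).2]
    simp
  exact (measureReal_eq_zero_iff (measure_ne_top _ _)).1 hr

/-- An event on which some weight-`0` coordinate of a fixed finite list is open is null. -/
theorem sigmaRec_null (p : Sym2 (Fin n) → unitInterval) (L : Set (BondConfig (Fin n)))
    (T : Finset (Sym2 (Fin n))) (hT : ∀ e ∈ T, p e = 0) (hL : ∀ ω ∈ L, ∃ e ∈ T, e ∈ ω) :
    (prodBernoulli p).real L = 0 := by
  have hsub : L ⊆ ⋃ e ∈ T, {ω : BondConfig (Fin n) | e ∈ ω} := by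
    intro ω hω
    obtain ⟨e, he, heω⟩ := hL ω hω
    exact Set.mem_iUnion₂.2 ⟨e, he, heω⟩
  refine measureReal_mono_null hsub
    (le_antisymm ((measureReal_biUnion_finset_le T _).trans (le_of_eq ?_)) measureReal_nonneg)
    (measure_ne_top _ _)
  refine Finset.sum_eq_zero fun e he => ?_
  rw [Literature.Probability.LatticeModels.prodBernoulli_real_setOf_mem, hT e he]
  rfl

/-- Inside a conull event `K`, two events agreeing on `L ∩ K` have the same mass on `L`. -/
theorem sigmaRec_inter_congr (p : Sym2 (Fin n) → unitInterval)
    {K L F G : Set (BondConfig (Fin n))} (hKc : prodBernoulli p Kᶜ = 0)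
    (h : ∀ ω, ω ∈ L → ω ∈ K → (ω ∈ F ↔ ω ∈ G)) :
    (prodBernoulli p).real (L ∩ F) = (prodBernoulli p).real (L ∩ G) := by
  have hset : L ∩ F ∩ K = L ∩ G ∩ K := by
    ext ω
    constructor
    · rintro ⟨⟨hL, hF⟩, hK⟩
      exact ⟨⟨hL, (h ω hL hK).1 hF⟩, hK⟩
    · rintro ⟨⟨hL, hG⟩, hK⟩
      exact ⟨⟨hL, (h ω hL hK).2 hG⟩, hK⟩
  rw [measureReal_def, measureReal_def, ← measure_inter_conull (s := L ∩ F) hKc, hset,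
    measure_inter_conull hKc]

/-- Termwise comparison of finite convex combinations: if `Σ c = 1`, `c ≥ 0` and
`α - β ≤ 1 - γ` wherever `c ≠ 0`, then `Σ c α - Σ c β ≤ 1 - Σ c γ`. -/
theorem sigmaRec_assembly {ι : Type*} (s : Finset ι) (c α β γ : ι → ℝ)
    (hc : ∀ i ∈ s, 0 ≤ c i) (hone : ∑ i ∈ s, c i = 1)
    (hkey : ∀ i ∈ s, c i ≠ 0 → α i - β i ≤ 1 - γ i) :
    ∑ i ∈ s, c i * α i - ∑ i ∈ s, c i * β i ≤ 1 - ∑ i ∈ s, c i * γ i := by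
  have h : ∑ i ∈ s, (c i * α i - c i * β i) ≤ ∑ i ∈ s, (c i - c i * γ i) := by
    refine Finset.sum_le_sum fun i hi => ?_
    rcases eq_or_ne (c i) 0 with h0 | h0
    · simp [h0]
    · have h := mul_le_mul_of_nonneg_left (hkey i hi h0) (hc i hi)
      rw [mul_sub, mul_sub, mul_one] at h
      exact h
  rw [Finset.sum_sub_distrib, Finset.sum_sub_distrib, hone] at h
  exact h

/-! ### The engine with abstract ingredients -/

/-- If the layer event `L_S` has positive mass under weights `p` that agree with `w` on the pairs
`s(o, x)`, `x ∉ O`, then `S` is a positive layer: `∀ x ∈ S, x ∉ O ∧ ∃ o ∈ O, w s(o,x) ≠ 0`. -/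
theorem sigmaRec_posLayer (w p : Sym2 (Fin n) → unitInterval) (O S : Finset (Fin n))
    (hpO : ∀ o x : Fin n, x ∉ O → p s(o, x) = w s(o, x))
    (hne : (prodBernoulli p).real
      {ω : BondConfig (Fin n) | ∀ x : Fin n, x ∈ S ↔ (x ∉ O ∧ ∃ o ∈ O, s(o, x) ∈ ω)} ≠ 0) :
    ∀ x ∈ S, x ∉ O ∧ ∃ o ∈ O, w s(o, x) ≠ 0 := by
  intro x hxS
  by_contra hcon
  apply hne
  by_cases hxO : x ∈ O
  · have hempty : {ω : BondConfig (Fin n) | ∀ x : Fin n, x ∈ S ↔ (x ∉ O ∧ ∃ o ∈ O, s(o, x) ∈ ω)}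
        = ∅ :=
      Set.eq_empty_iff_forall_notMem.2 fun ω hω => ((hω x).1 hxS).1 hxO
    rw [hempty, measureReal_empty]
  · have hw : ∀ o ∈ O, w s(o, x) = 0 := by
      by_contra hw'
      push Not at hw'
      exact hcon ⟨hxO, hw'⟩
    refine sigmaRec_null p _ (O.image fun o => s(o, x)) ?_ ?_
    · intro e he
      obtain ⟨o, ho, rfl⟩ := Finset.mem_image.1 he
      rw [hpO o x hxO, hw o ho]
    · intro ω hω
      obtain ⟨-, o, ho, hox⟩ := (hω x).1 hxS
      exact ⟨s(o, x), Finset.mem_image_of_mem _ ho, hox⟩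

/-- **The σ-recursion engine, abstract form.**  `p` = glued weights, `q S` = weights of the
block-deleted graph with the layer `S` glued, `Ψ S` = the off-block/glued configuration map,
`K` = the conull clique event; geometry (`hgeoA`, `hgeob`, `hgeoab`) and law (`hlaw`) are
hypotheses, as are the Lemma-5 comparison `hL5` and the designated inequality `hdef`. -/
theorem sigmaRec_engine (w p : Sym2 (Fin n) → unitInterval)
    (q : Finset (Fin n) → Sym2 (Fin n) → unitInterval) (O A : Finset (Fin n)) (b a : Fin n)
    (Ψ : Finset (Fin n) → BondConfig (Fin n) → BondConfig (Fin n)) (K : Set (BondConfig (Fin n)))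
    (hK : ∀ ω, ω ∉ K → ∃ e, p e = 1 ∧ e ∉ ω)
    (hpO : ∀ o x : Fin n, x ∉ O → p s(o, x) = w s(o, x))
    (hgeoA : ∀ (S : Finset (Fin n)) (ω : BondConfig (Fin n)),
      (∀ x : Fin n, x ∈ S ↔ (x ∉ O ∧ ∃ o ∈ O, s(o, x) ∈ ω)) → ω ∈ K →
      (ω ∈ (⋃ o ∈ O, ⋃ x ∈ A, openConn o x) ↔ Ψ S ω ∈ (⋃ s ∈ S, ⋃ x ∈ A, openConn s x)))
    (hgeob : ∀ (S : Finset (Fin n)) (ω : BondConfig (Fin n)),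
      (∀ x : Fin n, x ∈ S ↔ (x ∉ O ∧ ∃ o ∈ O, s(o, x) ∈ ω)) → ω ∈ K →
      (ω ∈ (⋃ o ∈ O, openConn o b) ↔ Ψ S ω ∈ (⋃ s ∈ S, openConn s b)))
    (hgeoab : ∀ (S : Finset (Fin n)) (ω : BondConfig (Fin n)),
      (∀ x : Fin n, x ∈ S ↔ (x ∉ O ∧ ∃ o ∈ O, s(o, x) ∈ ω)) → ω ∈ K →
      (ω ∈ openConn a b ↔ Ψ S ω ∈ openConn a b))
    (hlaw : ∀ (S : Finset (Fin n)) (E : Set (BondConfig (Fin n))),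
      (prodBernoulli p).real
          ({ω | ∀ x : Fin n, x ∈ S ↔ (x ∉ O ∧ ∃ o ∈ O, s(o, x) ∈ ω)} ∩ {ω | Ψ S ω ∈ E}) =
        (prodBernoulli p).real {ω | ∀ x : Fin n, x ∈ S ↔ (x ∉ O ∧ ∃ o ∈ O, s(o, x) ∈ ω)} *
          (prodBernoulli (q S)).real E)
    (hL5 : ∀ S : Finset (Fin n), (∀ x ∈ S, x ∉ O ∧ ∃ o ∈ O, w s(o, x) ≠ 0) →
      (S ∩ A).Nonempty → b ∉ S →
      (prodBernoulli (q S)).real (openConn a b) ≤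
        (prodBernoulli (q S)).real (⋃ s ∈ S, openConn s b))
    (hdef : ∀ S : Finset (Fin n), (∀ x ∈ S, x ∉ O ∧ ∃ o ∈ O, w s(o, x) ≠ 0) →
      S.Nonempty → Disjoint S A → b ∉ S →
      (prodBernoulli (q S)).real (⋃ s ∈ S, ⋃ x ∈ A, openConn s x) -
          (prodBernoulli (q S)).real (⋃ s ∈ S, openConn s b) ≤
        1 - (prodBernoulli (q S)).real (openConn a b)) :
    (prodBernoulli p).real (⋃ o ∈ O, ⋃ x ∈ A, openConn o x) -
        (prodBernoulli p).real (⋃ o ∈ O, openConn o b) ≤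
      1 - (prodBernoulli p).real (openConn a b) := by
  have hKc : prodBernoulli p Kᶜ = 0 := sigmaRec_conull p K hK
  -- factorisation of `μ(L_S ∩ F)` for an event `F` that is `Ψ_S⁻¹ F'` on `L_S ∩ K`
  have hfac : ∀ (S : Finset (Fin n)) (F F' : Set (BondConfig (Fin n))),
      (∀ ω : BondConfig (Fin n), (∀ x : Fin n, x ∈ S ↔ (x ∉ O ∧ ∃ o ∈ O, s(o, x) ∈ ω)) →
        ω ∈ K → (ω ∈ F ↔ Ψ S ω ∈ F')) →
      (prodBernoulli p).real
          ({ω | ∀ x : Fin n, x ∈ S ↔ (x ∉ O ∧ ∃ o ∈ O, s(o, x) ∈ ω)} ∩ F) =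
        (prodBernoulli p).real {ω | ∀ x : Fin n, x ∈ S ↔ (x ∉ O ∧ ∃ o ∈ O, s(o, x) ∈ ω)} *
          (prodBernoulli (q S)).real F' := by
    intro S F F' hFF'
    rw [← hlaw S F']
    exact sigmaRec_inter_congr p hKc fun ω hL hKω => hFF' ω hL hKω
  -- the three partitions, factorised
  have hA : (prodBernoulli p).real (⋃ o ∈ O, ⋃ x ∈ A, openConn o x) =
      ∑ S : Finset (Fin n),
        (prodBernoulli p).real {ω | ∀ x : Fin n, x ∈ S ↔ (x ∉ O ∧ ∃ o ∈ O, s(o, x) ∈ ω)} *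
          (prodBernoulli (q S)).real (⋃ s ∈ S, ⋃ x ∈ A, openConn s x) := by
    rw [sigmaRec_partition p O]
    exact Finset.sum_congr rfl fun S _ => hfac S _ _ (hgeoA S)
  have hb : (prodBernoulli p).real (⋃ o ∈ O, openConn o b) =
      ∑ S : Finset (Fin n),
        (prodBernoulli p).real {ω | ∀ x : Fin n, x ∈ S ↔ (x ∉ O ∧ ∃ o ∈ O, s(o, x) ∈ ω)} *
          (prodBernoulli (q S)).real (⋃ s ∈ S, openConn s b) := by
    rw [sigmaRec_partition p O]
    exact Finset.sum_congr rfl fun S _ => hfac S _ _ (hgeob S)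
  have hab : (prodBernoulli p).real (openConn a b) =
      ∑ S : Finset (Fin n),
        (prodBernoulli p).real {ω | ∀ x : Fin n, x ∈ S ↔ (x ∉ O ∧ ∃ o ∈ O, s(o, x) ∈ ω)} *
          (prodBernoulli (q S)).real (openConn a b) := by
    rw [sigmaRec_partition p O]
    exact Finset.sum_congr rfl fun S _ => hfac S _ _ (hgeoab S)
  have hone : ∑ S : Finset (Fin n),
      (prodBernoulli p).real {ω | ∀ x : Fin n, x ∈ S ↔ (x ∉ O ∧ ∃ o ∈ O, s(o, x) ∈ ω)} = 1 := by
    have h := sigmaRec_partition p O Set.univ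
    simp only [Set.inter_univ, probReal_univ] at h
    exact h.symm
  rw [hA, hb, hab]
  refine sigmaRec_assembly Finset.univ _ _ _ _ (fun S _ => measureReal_nonneg) hone ?_
  -- the termwise inequality
  intro S _ hS0
  have hS := sigmaRec_posLayer w p O S hpO hS0
  have hα : (prodBernoulli (q S)).real (⋃ s ∈ S, ⋃ x ∈ A, openConn s x) ≤ 1 := measureReal_le_one
  have hγ : (prodBernoulli (q S)).real (openConn a b) ≤ 1 := measureReal_le_one
  have hβ : 0 ≤ (prodBernoulli (q S)).real (⋃ s ∈ S, openConn s b) := measureReal_nonneg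
  by_cases hSe : S = ∅
  · subst hSe
    have h0 : (prodBernoulli (q ∅)).real
        (⋃ s ∈ (∅ : Finset (Fin n)), ⋃ x ∈ A, openConn s x) = 0 := by
      simp
    linarith
  by_cases hbS : b ∈ S
  · have h1 : (prodBernoulli (q S)).real (⋃ s ∈ S, openConn s b) = 1 := by
      have huniv : (⋃ s ∈ S, openConn s b : Set (BondConfig (Fin n))) = Set.univ :=
        Set.eq_univ_of_forall fun ω =>
          Set.mem_iUnion₂.2 ⟨b, hbS, (SimpleGraph.Reachable.refl b : ω ∈ openConn b b)⟩
      rw [huniv, probReal_univ]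
    linarith
  by_cases hSA : (S ∩ A).Nonempty
  · have h5 := hL5 S hS hSA hbS
    linarith
  · exact hdef S hS (Finset.nonempty_iff_ne_empty.2 hSe)
      (Finset.disjoint_iff_inter_eq_empty.2 (Finset.not_nonempty_iff_eq_empty.1 hSA)) hbS

/-! ### The registered stub -/

/-- **stub_sigmaRecursion — the σ-recursion engine (bookkeeping), given the geometry and the law
of the layer decomposition as displayed hypotheses.**  Under `glue w O`, a.s. all non-loop pairs
inside `O` are open (weight 1) and the layer `S` of the configuration satisfies
`∀ x ∈ S, x ∉ O ∧ ∃ o ∈ O, w s(o,x) ≠ 0` (an open pair has positive weight); partition by the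
value of the layer (`Σ_S`), rewrite each of the three events `{O ↔ A}`, `{O ↔ b}`, `{a ↔ b}`
through `Ψ_S` (geometry) and factor (law).  The designated deficit of `(w, O)` becomes
`Σ_S μ{layer = S} · [P'(S↔A) − P'(S↔b) + P'(a↔b) − 1]` with
`P' = prodBernoulli (glue (kill w O) S)`; every bracket is `≤ 0`: `S = ∅` (`P'(∅ ↔ ·) = 0`),
`b ∈ S` (`P'(S↔b) = 1`), `S ∩ A ≠ ∅` (`P'(S↔A) ≤ 1` and the Lemma-5 comparison `hL5`), `S`
avoiding `A ∪ {b}` (the designated inequality `hdef`).  (Kozma–Nitzan arXiv:2401.12397, proofs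
of Thms 4–5 pp. 13–14.) -/
theorem stub_sigmaRecursion :
    ∀ (n : ℕ) (w : Sym2 (Fin n) → unitInterval) (O A : Finset (Fin n)) (b a : Fin n),
      Disjoint O A → b ∉ O → a ∈ A →
      (∀ (S : Finset (Fin n)) (ω : BondConfig (Fin n)),
        (∀ x : Fin n, x ∈ S ↔ (x ∉ O ∧ ∃ o ∈ O, s(o, x) ∈ ω)) →
        (∀ o ∈ O, ∀ o' ∈ O, o ≠ o' → s(o, o') ∈ ω) →
        (∀ X : Finset (Fin n), Disjoint O X →
            (ω ∈ (⋃ o ∈ O, ⋃ x ∈ X, openConn o x) ↔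
              ({e | e ∈ ω ∧ ∀ x ∈ e, x ∉ O} ∪ {e | (∀ x ∈ e, x ∈ S) ∧ ¬ e.IsDiag}) ∈
                (⋃ s ∈ S, ⋃ x ∈ X, openConn s x))) ∧
        (∀ u v : Fin n, u ∉ O → v ∉ O →
            (ω ∈ openConn u v ↔
              ({e | e ∈ ω ∧ ∀ x ∈ e, x ∉ O} ∪ {e | (∀ x ∈ e, x ∈ S) ∧ ¬ e.IsDiag}) ∈
                openConn u v))) →
      (∀ (S : Finset (Fin n)) (E : Set (BondConfig (Fin n))),
        (prodBernoulli (fun e : Sym2 (Fin n) =>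
            if (∀ x ∈ e, x ∈ O) ∧ ¬ e.IsDiag then 1 else w e)).real
            ({ω | ∀ x : Fin n, x ∈ S ↔ (x ∉ O ∧ ∃ o ∈ O, s(o, x) ∈ ω)} ∩
              {ω | ({e | e ∈ ω ∧ ∀ x ∈ e, x ∉ O} ∪ {e | (∀ x ∈ e, x ∈ S) ∧ ¬ e.IsDiag}) ∈ E}) =
          (prodBernoulli (fun e : Sym2 (Fin n) =>
              if (∀ x ∈ e, x ∈ O) ∧ ¬ e.IsDiag then 1 else w e)).real
              {ω | ∀ x : Fin n, x ∈ S ↔ (x ∉ O ∧ ∃ o ∈ O, s(o, x) ∈ ω)} *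
            (prodBernoulli (fun e : Sym2 (Fin n) =>
              if (∀ x ∈ e, x ∈ S) ∧ ¬ e.IsDiag then 1 else
                if (∃ x ∈ e, x ∈ O) then 0 else w e)).real E) →
      (∀ S : Finset (Fin n), (∀ x ∈ S, x ∉ O ∧ ∃ o ∈ O, w s(o, x) ≠ 0) →
        (S ∩ A).Nonempty → b ∉ S →
        (prodBernoulli (fun e : Sym2 (Fin n) =>
            if (∀ x ∈ e, x ∈ S) ∧ ¬ e.IsDiag then 1 else
              if (∃ x ∈ e, x ∈ O) then 0 else w e)).real (openConn a b) ≤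
          (prodBernoulli (fun e : Sym2 (Fin n) =>
            if (∀ x ∈ e, x ∈ S) ∧ ¬ e.IsDiag then 1 else
              if (∃ x ∈ e, x ∈ O) then 0 else w e)).real (⋃ s ∈ S, openConn s b)) →
      (∀ S : Finset (Fin n), (∀ x ∈ S, x ∉ O ∧ ∃ o ∈ O, w s(o, x) ≠ 0) →
        S.Nonempty → Disjoint S A → b ∉ S →
        (prodBernoulli (fun e : Sym2 (Fin n) =>
            if (∀ x ∈ e, x ∈ S) ∧ ¬ e.IsDiag then 1 else
              if (∃ x ∈ e, x ∈ O) then 0 else w e)).real (⋃ s ∈ S, ⋃ x ∈ A, openConn s x) -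
          (prodBernoulli (fun e : Sym2 (Fin n) =>
            if (∀ x ∈ e, x ∈ S) ∧ ¬ e.IsDiag then 1 else
              if (∃ x ∈ e, x ∈ O) then 0 else w e)).real (⋃ s ∈ S, openConn s b) ≤
          1 - (prodBernoulli (fun e : Sym2 (Fin n) =>
            if (∀ x ∈ e, x ∈ S) ∧ ¬ e.IsDiag then 1 else
              if (∃ x ∈ e, x ∈ O) then 0 else w e)).real (openConn a b)) →
      (prodBernoulli (fun e : Sym2 (Fin n) =>
          if (∀ x ∈ e, x ∈ O) ∧ ¬ e.IsDiag then 1 else w e)).real (⋃ o ∈ O, ⋃ x ∈ A, openConn o x) -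
        (prodBernoulli (fun e : Sym2 (Fin n) =>
          if (∀ x ∈ e, x ∈ O) ∧ ¬ e.IsDiag then 1 else w e)).real (⋃ o ∈ O, openConn o b) ≤
        1 - (prodBernoulli (fun e : Sym2 (Fin n) =>
          if (∀ x ∈ e, x ∈ O) ∧ ¬ e.IsDiag then 1 else w e)).real (openConn a b) := by
  intro n w O A b a hOA hb ha hgeo hlaw hL5 hdef
  have haO : a ∉ O := fun h => Finset.disjoint_left.1 hOA h ha
  refine sigmaRec_engine w
    (fun e : Sym2 (Fin n) => if (∀ x ∈ e, x ∈ O) ∧ ¬ e.IsDiag then 1 else w e)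
    (fun (S : Finset (Fin n)) (e : Sym2 (Fin n)) =>
      if (∀ x ∈ e, x ∈ S) ∧ ¬ e.IsDiag then 1 else if (∃ x ∈ e, x ∈ O) then 0 else w e)
    O A b a
    (fun (S : Finset (Fin n)) (ω : BondConfig (Fin n)) =>
      {e | e ∈ ω ∧ ∀ x ∈ e, x ∉ O} ∪ {e | (∀ x ∈ e, x ∈ S) ∧ ¬ e.IsDiag})
    {ω | ∀ o ∈ O, ∀ o' ∈ O, o ≠ o' → s(o, o') ∈ ω} ?_ ?_ ?_ ?_ ?_ hlaw hL5 hdef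
  · -- outside the clique event some weight-1 pair is closed
    intro ω hω
    simp only [Set.mem_setOf_eq] at hω
    push Not at hω
    obtain ⟨o, ho, o', ho', hne, hnot⟩ := hω
    refine ⟨s(o, o'), ?_, hnot⟩
    show (if (∀ y ∈ s(o, o'), y ∈ O) ∧ ¬ (s(o, o')).IsDiag then (1 : unitInterval)
      else w s(o, o')) = 1
    rw [if_pos]
    refine ⟨fun y hy => ?_, fun hd => hne (Sym2.mk_isDiag_iff.1 hd)⟩
    rcases Sym2.mem_iff.1 hy with rfl | rfl
    · exact ho
    · exact ho'
  · -- the glued weight of a pair leaving `O` is the original weight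
    intro o x hx
    show (if (∀ y ∈ s(o, x), y ∈ O) ∧ ¬ (s(o, x)).IsDiag then (1 : unitInterval)
      else w s(o, x)) = w s(o, x)
    rw [if_neg]
    rintro ⟨h, -⟩
    exact hx (h x (Sym2.mem_mk_right o x))
  · intro S ω hL hK
    exact (hgeo S ω hL hK).1 A hOA
  · intro S ω hL hK
    have h := (hgeo S ω hL hK).1 {b} (Finset.disjoint_singleton_right.2 hb)
    simpa only [Finset.set_biUnion_singleton] using h
  · intro S ω hL hK
    exact (hgeo S ω hL hK).2 a b haO hb

end

end Summit.CriticalPhenomena.PercolationContinuityZ3.Theorems
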